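import Mathlib
import Literature.Analysis.FluidPDE.ClassicalSolution
import Literature.Analysis.FluidPDE.LerayHopf
import Literature.Analysis.FluidPDE.NSWave0
import Literature.Analysis.FluidPDE.TaoLocalisation
import Summits.NavierStokesRegularity.NavierStokesRegularity.Theses.L3TimeExponentPincer
import Summits.NavierStokesRegularity.NavierStokesRegularity.Theorems.L3TimeExponentPincerJawSuperEuler
import Summits.NavierStokesRegularity.NavierStokesRegularity.Theorems.L3TimeExponentPincerJawSubEulerEddy
import HarnessLib

/-!
# The Euler box of crux `L3CascadeJaw` (stmt-NavierStokesRegularity-19499): fast times × super-Euler speeds ×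
# sub-Euler scales

Support file for the PARENT crux `L3CascadeJaw` of route `L3TimeExponentPincer` (cell ns-regularity-ideate, seat
ns-pincer-19499-p1 g2); third of the localisation triple after `L3TimeExponentPincerJawSuperEuler` (SPEED,
p471620) and `L3TimeExponentPincerJawSubEulerEddy` (SCALE, p473776).  Everything is energy-level and
unconditional; the point is the combined, quotable form of the crux.

* §1 `superLevel_clause_iff` — the speed localisation of p471620 for an ARBITRARY measurable family `w(t,·)` of
  uniformly finite energy (`∫|w(t)|² ≤ m` on `[0,T)`): for `K ≥ 0`, `θ ≤ 3/5`, `0 ≤ q < 5`,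
  `∫_{T₂}^T (∫|w(t)|³)^{q/3} < ∞` on a final window ⟺ the same for `∫_{|w(t)|>K(T-t)^{-θ}} |w(t)|³`
  (reusable: the frame velocity, its sub-eddy fluctuation, any other finite-energy derived field).
* §2 `jawClauseAt_iff_fastTimes` — TIME localisation (pure measure theory, no frame hypothesis): for `M ≥ 0`,
  `0 ≤ q < 5`, the clause at `q` ⟺ the clause at `q` integrated only over the SUPER-EULER TIMES
  `{t : ‖u(t)‖₃ > M (T-t)^{-1/5}}` (slow times contribute `≤ M^q (T-t)^{-q/5}`, integrable iff `q < 5`).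
* §3 `lintegral_enorm_sub_sq_le`, `jawClauseAt_iff_eulerBox`, `l3CascadeJaw_iff_eulerBox` — SPEED × SCALE: for a
  frame solution, `K₁ > 0`, `σ ≤ 2/5`, `K₂ ≥ 0`, `θ ≤ 3/5`, `0 ≤ q < 5`, with the sub-eddy fluctuation
  `w = u - A_{K₁(T-t)^σ} u` (top-hat average `A_ρ`): the clause at `q` ⟺
  `∫_{T₂}^T (∫_{|w(t)|>K₂(T-t)^{-θ}} |w(t)|³)^{q/3} dt < ∞` on a final window; and the crux BY NAME ⟺ this EULER-BOX
  form at the sharp corner `σ = 2/5`, `θ = 3/5` (any `K₁ > 0`, `K₂ > 0`): "for every frame solution the `L³`-mass of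
  the fluid that is BOTH finer than the Euler-eddy scale `r_E = K₁(T-t)^{2/5}` AND faster than the Euler speed
  `U_E = K₂(T-t)^{-3/5}` is `L^{q/3}`-integrable up to `T` for every `q < 5`".

Numbers: `U_E r_E ∼ (T-t)^{-1/5}` (the jaw's `L³` rate), `U_E² r_E³ ∼ 1` (one box carries `O(E₀)` energy),
`r_E/U_E ∼ (T-t)` (one box turns over in the remaining time): the Euler box is the unique energy-level cell on
which the crux is decided; sub-Euler speeds, super-Euler scales and sub-Euler times are all provably harmless.

WHAT THIS IS NOT: not a claim about Navier–Stokes regularity or blow-up and no progress on the crux's open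
content; a reformulation landed `--supports stmt-NavierStokesRegularity-19499`.
-/

noncomputable section

namespace Summit.NavierStokesRegularity.NavierStokesRegularity.Theorems.L3TimeExponentPincerJawEulerBox

open MeasureTheory Set Function Filter Metric Topology
open scoped ENNReal NNReal
open Literature.Analysis.FluidPDE
open Summit.NavierStokesRegularity.NavierStokesRegularity.Theses.L3TimeExponentPincer (L3CascadeJaw)
open Summit.NavierStokesRegularity.NavierStokesRegularity.Theorems.L3TimeExponentPincerEffNode
  (lintegral_Ioo_ofReal_mul_rpow_lt_top)
open Summit.NavierStokesRegularity.NavierStokesRegularity.Theorems.L3TimeExponentPincerJawFullMorrey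
  (eLpNorm_three_rpow_eq)
open Summit.NavierStokesRegularity.NavierStokesRegularity.Theorems.L3TimeExponentPincerDissipationAxis
  (add_rpow_le_two_rpow)
open Summit.NavierStokesRegularity.NavierStokesRegularity.Theorems.L3TimeExponentPincerJawSuperEuler
  (lintegral_enorm_cube_le_split_level lintegral_low_rpow_lt_top)
open Summit.NavierStokesRegularity.NavierStokesRegularity.Theorems.L3TimeExponentPincerJawSubEulerEddy
  (continuous_ballAvg lintegral_enorm_ballAvg_sq_le jawClauseAt_iff_subEulerEddy)

/-! ## §1  Speed localisation for an arbitrary finite-energy family -/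

/-- **Super-level localisation, general form.**  Let `w(t,·)` (`t ∈ [0,T)`) be measurable fields with
`∫|w(t)|² ≤ m` (`m ≥ 0`).  For `K ≥ 0`, `θ ≤ 3/5`, `0 ≤ q < 5`:
`∫_{T₂}^T (∫|w(t)|³)^{q/3} dt < ∞` on some final window ⟺
`∫_{T₂}^T (∫_{|w(t,x)|>K(T-t)^{-θ}} |w(t,x)|³ dx)^{q/3} dt < ∞` on some final window
(the sub-level fluid contributes `≤ (mK)^{q/3}(T-t)^{-θq/3}`, and `θq/3 ≤ q/5 < 1`). -/
theorem superLevel_clause_iff {T : ℝ}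
    {w : ℝ → EuclideanSpace ℝ (Fin 3) → EuclideanSpace ℝ (Fin 3)} {m : ℝ} (hm : 0 ≤ m)
    (hmeas : ∀ t ∈ Ico 0 T, Measurable (w t))
    (hE : ∀ t ∈ Ico 0 T, ∫⁻ x, ‖w t x‖ₑ ^ 2 ≤ ENNReal.ofReal m)
    {K : ℝ} (hK : 0 ≤ K) {θ : ℝ} (hθ : θ ≤ 3 / 5) {q : ℝ} (hq0 : 0 ≤ q) (hq5 : q < 5) :
    (∃ T₂ ∈ Ioo 0 T, (∫⁻ t in Ioo T₂ T, (∫⁻ x, ‖w t x‖ₑ ^ 3) ^ (q / 3)) < ⊤) ↔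
      ∃ T₂ ∈ Ioo 0 T, (∫⁻ t in Ioo T₂ T,
        (∫⁻ x in {y | K * (T - t) ^ (-θ) < ‖w t y‖}, ‖w t x‖ₑ ^ 3) ^ (q / 3)) < ⊤ := by
  have hq3 : 0 ≤ q / 3 := by positivity
  constructor
  · rintro ⟨T₂, hT₂, hfin⟩
    refine ⟨T₂, hT₂, lt_of_le_of_lt (lintegral_mono fun t => ?_) hfin⟩
    exact ENNReal.rpow_le_rpow (setLIntegral_le_lintegral _ _) hq3
  · rintro ⟨T₂, hT₂, hfin⟩
    refine ⟨T₂, hT₂, ?_⟩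
    set low : ℝ → ℝ≥0∞ := fun t =>
      ENNReal.ofReal ((m * K) ^ (q / 3) * (T - t) ^ (-(θ * (q / 3)))) with hlow
    have hlow_meas : Measurable low := by
      rw [hlow]
      exact (measurable_const.mul ((measurable_const.sub measurable_id).pow_const _)).ennreal_ofReal
    set high : ℝ → ℝ≥0∞ := fun t =>
      (∫⁻ x in {y | K * (T - t) ^ (-θ) < ‖w t y‖}, ‖w t x‖ₑ ^ 3) ^ (q / 3) with hhigh
    have hmK : 0 ≤ m * K := mul_nonneg hm hK
    have hpt : ∀ t ∈ Ioo T₂ T, (∫⁻ x, ‖w t x‖ₑ ^ 3) ^ (q / 3) ≤ (2 : ℝ≥0∞) ^ (q / 3) * (low t + high t) := by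
      intro t ht
      have ht' : t ∈ Ico 0 T := ⟨(hT₂.1.trans ht.1).le, ht.2⟩
      have hs : 0 < T - t := sub_pos.2 ht.2
      have hl : 0 ≤ K * (T - t) ^ (-θ) := mul_nonneg hK (Real.rpow_nonneg hs.le _)
      have hsplit : ∫⁻ x, ‖w t x‖ₑ ^ 3 ≤ ENNReal.ofReal (m * K * (T - t) ^ (-θ)) +
          ∫⁻ x in {y | K * (T - t) ^ (-θ) < ‖w t y‖}, ‖w t x‖ₑ ^ 3 := by
        calc ∫⁻ x, ‖w t x‖ₑ ^ 3
            ≤ ENNReal.ofReal (K * (T - t) ^ (-θ)) * (∫⁻ x, ‖w t x‖ₑ ^ 2) +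
                ∫⁻ x in {y | K * (T - t) ^ (-θ) < ‖w t y‖}, ‖w t x‖ₑ ^ 3 :=
              lintegral_enorm_cube_le_split_level (hmeas t ht') _
          _ ≤ ENNReal.ofReal (K * (T - t) ^ (-θ)) * ENNReal.ofReal m +
                ∫⁻ x in {y | K * (T - t) ^ (-θ) < ‖w t y‖}, ‖w t x‖ₑ ^ 3 := by
              gcongr
              exact hE t ht'
          _ = _ := by rw [← ENNReal.ofReal_mul hl]; congr 2; ring
      calc (∫⁻ x, ‖w t x‖ₑ ^ 3) ^ (q / 3)
          ≤ (ENNReal.ofReal (m * K * (T - t) ^ (-θ)) +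
              ∫⁻ x in {y | K * (T - t) ^ (-θ) < ‖w t y‖}, ‖w t x‖ₑ ^ 3) ^ (q / 3) :=
            ENNReal.rpow_le_rpow hsplit hq3
        _ ≤ (2 : ℝ≥0∞) ^ (q / 3) * ((ENNReal.ofReal (m * K * (T - t) ^ (-θ))) ^ (q / 3) + high t) :=
            add_rpow_le_two_rpow _ _ hq3
        _ = (2 : ℝ≥0∞) ^ (q / 3) * (low t + high t) := by
            congr 2
            rw [hlow, ENNReal.ofReal_rpow_of_nonneg (mul_nonneg hmK (Real.rpow_nonneg hs.le _)) hq3,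
              Real.mul_rpow hmK (Real.rpow_nonneg hs.le _), ← Real.rpow_mul hs.le]
            ring_nf
    have hlow_fin : ∫⁻ t in Ioo T₂ T, low t < ⊤ := lintegral_low_rpow_lt_top hT₂.2 hθ hq0 hq5
    calc ∫⁻ t in Ioo T₂ T, (∫⁻ x, ‖w t x‖ₑ ^ 3) ^ (q / 3)
        ≤ ∫⁻ t in Ioo T₂ T, (2 : ℝ≥0∞) ^ (q / 3) * (low t + high t) :=
          setLIntegral_mono' measurableSet_Ioo hpt
      _ = (2 : ℝ≥0∞) ^ (q / 3) * ((∫⁻ t in Ioo T₂ T, low t) + ∫⁻ t in Ioo T₂ T, high t) := by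
          rw [lintegral_const_mul' _ _ (ENNReal.rpow_ne_top_of_nonneg hq3 ENNReal.ofNat_ne_top),
            lintegral_add_left hlow_meas]
      _ < ⊤ := by
          refine ENNReal.mul_lt_top (ENNReal.rpow_lt_top_of_nonneg hq3 ENNReal.ofNat_ne_top) ?_
          exact ENNReal.add_lt_top.2 ⟨hlow_fin, hfin⟩

/-! ## §2  Time localisation: only super-Euler times count -/

/-- **The clause lives on the super-Euler TIMES.**  For any field `u`, `M ≥ 0` and `0 ≤ q < 5`:
`∫_{T₂}^T ‖u(t)‖₃^q dt < ∞` on some final window ⟺ the same integral restricted to the times with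
`‖u(t)‖₃ > M (T-t)^{-1/5}` is finite on some final window (the slow times contribute `≤ M^q(T-t)^{-q/5}`,
integrable iff `q < 5`).  Pure measure theory: no frame hypothesis, no measurability needed. [folklore] -/
theorem jawClauseAt_iff_fastTimes {T : ℝ}
    (u : ℝ → EuclideanSpace ℝ (Fin 3) → EuclideanSpace ℝ (Fin 3)) {M : ℝ} (hM : 0 ≤ M)
    {q : ℝ} (hq0 : 0 ≤ q) (hq5 : q < 5) :
    (∃ T₂ ∈ Ioo 0 T, (∫⁻ t in Ioo T₂ T, eLpNorm (u t) 3 volume ^ q) < ⊤) ↔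
      ∃ T₂ ∈ Ioo 0 T, (∫⁻ t in Ioo T₂ T ∩
          {s | ENNReal.ofReal (M * (T - s) ^ (-(1 / 5 : ℝ))) < eLpNorm (u s) 3 volume},
        eLpNorm (u t) 3 volume ^ q) < ⊤ := by
  constructor
  · rintro ⟨T₂, hT₂, hfin⟩
    exact ⟨T₂, hT₂, lt_of_le_of_lt (lintegral_mono_set inter_subset_left) hfin⟩
  · rintro ⟨T₂, hT₂, hfin⟩
    refine ⟨T₂, hT₂, ?_⟩
    set S : Set ℝ := {s | ENNReal.ofReal (M * (T - s) ^ (-(1 / 5 : ℝ))) < eLpNorm (u s) 3 volume} with hS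
    set slow : ℝ → ℝ≥0∞ := fun t => ENNReal.ofReal (M ^ q * (T - t) ^ (-((1 / 5 : ℝ) * q))) with hslow
    have hslow_meas : Measurable slow := by
      rw [hslow]
      exact (measurable_const.mul ((measurable_const.sub measurable_id).pow_const _)).ennreal_ofReal
    have hpt : ∀ t ∈ Ioo T₂ T, eLpNorm (u t) 3 volume ^ q ≤
        S.indicator (fun s => eLpNorm (u s) 3 volume ^ q) t + slow t := by
      intro t ht
      have hs : 0 < T - t := sub_pos.2 ht.2
      by_cases htS : t ∈ S
      · rw [indicator_of_mem htS]; exact le_self_add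
      · rw [indicator_of_notMem htS, zero_add]
        have hle : eLpNorm (u t) 3 volume ≤ ENNReal.ofReal (M * (T - t) ^ (-(1 / 5 : ℝ))) := not_lt.1 htS
        have hMs : 0 ≤ M * (T - t) ^ (-(1 / 5 : ℝ)) := mul_nonneg hM (Real.rpow_nonneg hs.le _)
        calc eLpNorm (u t) 3 volume ^ q ≤ (ENNReal.ofReal (M * (T - t) ^ (-(1 / 5 : ℝ)))) ^ q :=
              ENNReal.rpow_le_rpow hle hq0
          _ = slow t := by
              rw [hslow, ENNReal.ofReal_rpow_of_nonneg hMs hq0, Real.mul_rpow hM (Real.rpow_nonneg hs.le _),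
                ← Real.rpow_mul hs.le, neg_mul]
    have hslow_fin : ∫⁻ t in Ioo T₂ T, slow t < ⊤ :=
      lintegral_Ioo_ofReal_mul_rpow_lt_top hT₂.2 _ _ (by nlinarith)
    calc ∫⁻ t in Ioo T₂ T, eLpNorm (u t) 3 volume ^ q
        ≤ ∫⁻ t in Ioo T₂ T, (S.indicator (fun s => eLpNorm (u s) 3 volume ^ q) t + slow t) :=
          setLIntegral_mono' measurableSet_Ioo hpt
      _ = (∫⁻ t in Ioo T₂ T, S.indicator (fun s => eLpNorm (u s) 3 volume ^ q) t) +
            ∫⁻ t in Ioo T₂ T, slow t := lintegral_add_right _ hslow_meas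
      _ ≤ (∫⁻ t in Ioo T₂ T ∩ S, eLpNorm (u t) 3 volume ^ q) + ∫⁻ t in Ioo T₂ T, slow t := by
          refine add_le_add_left ?_ _
          calc ∫⁻ t in Ioo T₂ T, S.indicator (fun s => eLpNorm (u s) 3 volume ^ q) t
              ≤ ∫⁻ t in S, eLpNorm (u t) 3 volume ^ q ∂(volume.restrict (Ioo T₂ T)) :=
                lintegral_indicator_le _ _
            _ = ∫⁻ t in Ioo T₂ T ∩ S, eLpNorm (u t) 3 volume ^ q := by
                rw [Measure.restrict_restrict' measurableSet_Ioo, inter_comm]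
      _ < ⊤ := ENNReal.add_lt_top.2 ⟨hfin, hslow_fin⟩

/-! ## §3  The Euler box: speed × scale -/

/-- `∫|a - b|² ≤ 2∫|a|² + 2∫|b|²` for measurable fields (parallelogram bound). [folklore] -/
theorem lintegral_enorm_sub_sq_le {a b : EuclideanSpace ℝ (Fin 3) → EuclideanSpace ℝ (Fin 3)}
    (ha : Measurable a) :
    ∫⁻ x, ‖a x - b x‖ₑ ^ 2 ≤ 2 * (∫⁻ x, ‖a x‖ₑ ^ 2) + 2 * ∫⁻ x, ‖b x‖ₑ ^ 2 := by
  have hpt : ∀ x, ‖a x - b x‖ₑ ^ 2 ≤ 2 * ‖a x‖ₑ ^ 2 + 2 * ‖b x‖ₑ ^ 2 := by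
    intro x
    have h1 : ‖a x - b x‖ ^ 2 ≤ 2 * ‖a x‖ ^ 2 + 2 * ‖b x‖ ^ 2 := by
      have h1a : ‖a x - b x‖ ^ 2 ≤ (‖a x‖ + ‖b x‖) ^ 2 :=
        pow_le_pow_left₀ (norm_nonneg _) (norm_sub_le (a x) (b x)) 2
      nlinarith [sq_nonneg (‖a x‖ - ‖b x‖)]
    have h2 : ENNReal.ofReal (‖a x - b x‖ ^ 2) ≤ ENNReal.ofReal (2 * ‖a x‖ ^ 2 + 2 * ‖b x‖ ^ 2) :=
      ENNReal.ofReal_le_ofReal h1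
    rw [ENNReal.ofReal_add (by positivity) (by positivity), ENNReal.ofReal_mul zero_le_two,
      ENNReal.ofReal_mul zero_le_two, ENNReal.ofReal_pow (norm_nonneg _), ENNReal.ofReal_pow (norm_nonneg _),
      ENNReal.ofReal_pow (norm_nonneg _), ofReal_norm, ofReal_norm, ofReal_norm, ENNReal.ofReal_ofNat] at h2
    exact h2
  calc ∫⁻ x, ‖a x - b x‖ₑ ^ 2 ≤ ∫⁻ x, (2 * ‖a x‖ₑ ^ 2 + 2 * ‖b x‖ₑ ^ 2) := lintegral_mono hpt
    _ = 2 * (∫⁻ x, ‖a x‖ₑ ^ 2) + 2 * ∫⁻ x, ‖b x‖ₑ ^ 2 := by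
        rw [lintegral_add_left ((ha.enorm.pow_const 2).const_mul _),
          lintegral_const_mul' _ (fun x => ‖a x‖ₑ ^ 2) ENNReal.ofNat_ne_top,
          lintegral_const_mul' _ (fun x => ‖b x‖ₑ ^ 2) ENNReal.ofNat_ne_top]

/-- **The clause ⟺ its Euler-box form (speed × scale).**  For a frame solution, `K₁ > 0`, `σ ≤ 2/5`, `K₂ ≥ 0`,
`θ ≤ 3/5`, `0 ≤ q < 5`, with the sub-eddy fluctuation `w(t) = u(t) - A_{K₁(T-t)^σ} u(t)`:
`∫_{T₂}^T ‖u(t)‖₃^q dt < ∞` on some final window ⟺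
`∫_{T₂}^T (∫_{|w(t,x)| > K₂(T-t)^{-θ}} |w(t,x)|³ dx)^{q/3} dt < ∞` on some final window. -/
theorem jawClauseAt_iff_eulerBox {ν T : ℝ} (hν : 0 < ν)
    {u : ℝ → EuclideanSpace ℝ (Fin 3) → EuclideanSpace ℝ (Fin 3)} {p : ℝ → EuclideanSpace ℝ (Fin 3) → ℝ}
    (hcl : IsClassicalNSSolutionOn (Ico 0 T) ν 0 u p) (hLH : IsLerayHopfOn T ν 0 (u 0) u)
    {K₁ : ℝ} (hK₁ : 0 < K₁) {σ : ℝ} (hσ : σ ≤ 2 / 5) {K₂ : ℝ} (hK₂ : 0 ≤ K₂) {θ : ℝ} (hθ : θ ≤ 3 / 5)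
    {q : ℝ} (hq0 : 0 ≤ q) (hq5 : q < 5) :
    (∃ T₂ ∈ Ioo 0 T, (∫⁻ t in Ioo T₂ T, eLpNorm (u t) 3 volume ^ q) < ⊤) ↔
      ∃ T₂ ∈ Ioo 0 T, (∫⁻ t in Ioo T₂ T,
        (∫⁻ x in {y | K₂ * (T - t) ^ (-θ) <
            ‖u t y - (volume (closedBall (0 : EuclideanSpace ℝ (Fin 3)) (K₁ * (T - t) ^ σ))).toReal⁻¹ •
              ∫ z in closedBall (0 : EuclideanSpace ℝ (Fin 3)) (K₁ * (T - t) ^ σ), u t (y + z)‖},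
          ‖u t x - (volume (closedBall (0 : EuclideanSpace ℝ (Fin 3)) (K₁ * (T - t) ^ σ))).toReal⁻¹ •
              ∫ z in closedBall (0 : EuclideanSpace ℝ (Fin 3)) (K₁ * (T - t) ^ σ), u t (x + z)‖ₑ ^ 3) ^
          (q / 3)) < ⊤ := by
  -- the fluctuation family and its energy bound `≤ 4 · 2E₀`
  set w : ℝ → EuclideanSpace ℝ (Fin 3) → EuclideanSpace ℝ (Fin 3) := fun t x =>
    u t x - (volume (closedBall (0 : EuclideanSpace ℝ (Fin 3)) (K₁ * (T - t) ^ σ))).toReal⁻¹ •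
      ∫ z in closedBall (0 : EuclideanSpace ℝ (Fin 3)) (K₁ * (T - t) ^ σ), u t (x + z) with hw
  set E₀ : ℝ := VectorCalculus.kineticEnergy (u 0) with hE₀
  have hE₀0 : 0 ≤ E₀ := by rw [hE₀]; exact kineticEnergy_nonneg _
  have hcont : ∀ t ∈ Ico 0 T, Continuous (u t) := fun t ht => (hcl.contDiff_velocity ht).continuous
  have hwmeas : ∀ t ∈ Ico 0 T, Measurable (w t) := fun t ht =>
    ((hcont t ht).sub (continuous_ballAvg (hcont t ht) _)).measurable
  have hwE : ∀ t ∈ Ico 0 T, ∫⁻ x, ‖w t x‖ₑ ^ 2 ≤ ENNReal.ofReal (4 * (2 * E₀)) := by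
    intro t ht
    have hs : 0 < T - t := sub_pos.2 ht.2
    have hρ : 0 < K₁ * (T - t) ^ σ := mul_pos hK₁ (Real.rpow_pos_of_pos hs σ)
    have hE := hLH.lintegral_enorm_sq_le hν.le (Ico_subset_Icc_self ht)
    have hA := lintegral_enorm_ballAvg_sq_le (hcont t ht) hρ
    calc ∫⁻ x, ‖w t x‖ₑ ^ 2
        ≤ 2 * (∫⁻ x, ‖u t x‖ₑ ^ 2) + 2 * ∫⁻ x,
            ‖(volume (closedBall (0 : EuclideanSpace ℝ (Fin 3)) (K₁ * (T - t) ^ σ))).toReal⁻¹ •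
              ∫ z in closedBall (0 : EuclideanSpace ℝ (Fin 3)) (K₁ * (T - t) ^ σ), u t (x + z)‖ₑ ^ 2 :=
          lintegral_enorm_sub_sq_le (hcont t ht).measurable
      _ ≤ 2 * ENNReal.ofReal (2 * E₀) + 2 * ENNReal.ofReal (2 * E₀) :=
          add_le_add (mul_le_mul' le_rfl hE) (mul_le_mul' le_rfl (hA.trans hE))
      _ = 4 * ENNReal.ofReal (2 * E₀) := by ring
      _ = ENNReal.ofReal (4 * (2 * E₀)) := by
          rw [ENNReal.ofReal_mul (by norm_num : (0 : ℝ) ≤ 4), ENNReal.ofReal_ofNat]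
  -- scale localisation, then speed localisation for `w`
  rw [jawClauseAt_iff_subEulerEddy hν hcl hLH hK₁ hσ hq0 hq5]
  have hre : ∀ t : ℝ, eLpNorm (w t) 3 volume ^ q = (∫⁻ x, ‖w t x‖ₑ ^ 3) ^ (q / 3) := fun t =>
    eLpNorm_three_rpow_eq _ _ _
  simp_rw [hw] at hre
  simp_rw [hre]
  exact superLevel_clause_iff (by positivity) hwmeas hwE hK₂ hθ hq0 hq5

/-- **`L3CascadeJaw` ⟺ its Euler-box form (BY NAME).**  For any fixed `K₁ > 0`, `K₂ > 0`: the crux holds iff for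
every `q ∈ (4,5)` and every frame solution the `L³`-mass of the fluid that is finer than the Euler-eddy scale
`K₁(T-t)^{2/5}` (the fluctuation `w = u - A_{K₁(T-t)^{2/5}} u`) and faster than the Euler speed `K₂(T-t)^{-3/5}`
satisfies `∫_{T₂}^T (∫_{|w(t)|>K₂(T-t)^{-3/5}} |w(t)|³)^{q/3} dt < ∞` on a final window. -/
theorem l3CascadeJaw_iff_eulerBox {K₁ K₂ : ℝ} (hK₁ : 0 < K₁) (hK₂ : 0 < K₂) :
    L3CascadeJaw ↔
      ∀ q : ℝ, 4 < q → q < 5 → ∀ (ν T : ℝ), 0 < ν → 0 < T →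
        ∀ (u : ℝ → EuclideanSpace ℝ (Fin 3) → EuclideanSpace ℝ (Fin 3)) (p : ℝ → EuclideanSpace ℝ (Fin 3) → ℝ),
          IsClassicalNSSolutionOn (Ico 0 T) ν 0 u p → IsLerayHopfOn T ν 0 (u 0) u →
          HasRapidSpatialDecay (u 0) →
          ∃ T₂ ∈ Ioo 0 T, (∫⁻ t in Ioo T₂ T,
            (∫⁻ x in {y | K₂ * (T - t) ^ (-(3 / 5 : ℝ)) <
                ‖u t y - (volume (closedBall (0 : EuclideanSpace ℝ (Fin 3)) (K₁ * (T - t) ^ (2 / 5 : ℝ)))).toReal⁻¹ •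
                  ∫ z in closedBall (0 : EuclideanSpace ℝ (Fin 3)) (K₁ * (T - t) ^ (2 / 5 : ℝ)), u t (y + z)‖},
              ‖u t x - (volume (closedBall (0 : EuclideanSpace ℝ (Fin 3)) (K₁ * (T - t) ^ (2 / 5 : ℝ)))).toReal⁻¹ •
                  ∫ z in closedBall (0 : EuclideanSpace ℝ (Fin 3)) (K₁ * (T - t) ^ (2 / 5 : ℝ)), u t (x + z)‖ₑ ^ 3) ^
              (q / 3)) < ⊤ := by
  unfold L3CascadeJaw
  constructor
  · intro h q hq4 hq5 ν T hν hT u p hcl hLH hdec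
    exact (jawClauseAt_iff_eulerBox hν hcl hLH hK₁ le_rfl hK₂.le le_rfl (by linarith) hq5).1
      (h q hq4 hq5 ν T hν hT u p hcl hLH hdec)
  · intro h q hq4 hq5 ν T hν hT u p hcl hLH hdec
    exact (jawClauseAt_iff_eulerBox hν hcl hLH hK₁ le_rfl hK₂.le le_rfl (by linarith) hq5).2
      (h q hq4 hq5 ν T hν hT u p hcl hLH hdec)

end Summit.NavierStokesRegularity.NavierStokesRegularity.Theorems.L3TimeExponentPincerJawEulerBox

end
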